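import Summits.MatrixMultiplication.OmegaCensus.STPPVosperSlackOnePairing

/-!
# ω-census (abelian STPP census): the case-γ window table WITH THE A-PAIRING premise as a `Bool` checker (kernel)

HONEST FRAMING (pub-omega census; verbatim): lottery ticket; floor = certified bounds/negative ranges.
Census STRUCTURE (seat pub-omega-stpp-2 gen 26, 2026-08-28), family (b2).  The hypothesis `htableγ` of the pairing law
(`STPPVosperSlackOneCoverLawA2P.lean`) is a `∀ j t, window → prefix → coverByF → j ∈ J` statement; with three premises the `Decidable` instance of the
whole statement is too large for instance synthesis, so kill files decide the `Bool` checker `tableGammaP` instead and apply `tableGammaP_spec`.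
Nothing here is progress on `ω`.
-/

open Finset

namespace Summit.MatrixMultiplication.OmegaCensus.CubeNB

/-- **Case-γ table checker with the A-pairing** (`Bool`): for all `j, t < p`: `j ∈ J`, or the `m` positions `(t + j·i) mod p` do not all lie in `[0, n)`,
or the prefix law `b ∣ pos − #(smaller positions)` fails somewhere, or the exact cover of the window complement by the combined pattern
`patN p j a [0,b)` (`coverByF`, fuel `fuel`) fails. [folklore] -/
def tableGammaP (p n m b a fuel : ℕ) (J : Finset ℕ) : Bool :=
  (List.range p).all fun j => (List.range p).all fun t =>
    decide (j ∈ J) ||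
    !((List.range m).all fun i => decide ((t + j * i) % p < n)) ||
    !((List.range m).all fun k => decide (b ∣ (t + j * k) % p - #((range m).filter fun i => (t + j * i) % p < (t + j * k) % p))) ||
    !(coverByF p (patN p j a (range b)) fuel ((range n).filter fun x => x ∉ (range m).image fun i => (t + j * i) % p))

/-- **Meaning of the case-γ checker with the pairing** (the `htableγ` hypothesis of the pairing law). [folklore] -/
theorem tableGammaP_spec {p n m b a fuel : ℕ} {J : Finset ℕ} (h : tableGammaP p n m b a fuel J = true) :
    ∀ j < p, ∀ t < p, (∀ i < m, (t + j * i) % p < n) →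
      (∀ k < m, b ∣ (t + j * k) % p - #((range m).filter fun i => (t + j * i) % p < (t + j * k) % p)) →
      coverByF p (patN p j a (range b)) fuel ((range n).filter fun x => x ∉ (range m).image fun i => (t + j * i) % p) = true → j ∈ J := by
  intro j hj t ht hwin hpre hcov
  rw [tableGammaP, List.all_eq_true] at h
  have h1 := h j (List.mem_range.2 hj)
  rw [List.all_eq_true] at h1
  have h2 := h1 t (List.mem_range.2 ht)
  rw [Bool.or_eq_true, Bool.or_eq_true, Bool.or_eq_true, decide_eq_true_eq, Bool.not_eq_true', Bool.not_eq_true', Bool.not_eq_true',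
    hcov] at h2
  rcases h2 with ((hJ | h3) | h3) | h3
  · exact hJ
  · exfalso
    rw [Bool.eq_false_iff] at h3
    apply h3
    rw [List.all_eq_true]
    intro i hi
    rw [decide_eq_true_eq]
    exact hwin i (List.mem_range.1 hi)
  · exfalso
    rw [Bool.eq_false_iff] at h3
    apply h3
    rw [List.all_eq_true]
    intro k hk
    rw [decide_eq_true_eq]
    exact hpre k (List.mem_range.1 hk)
  · exact Bool.noConfusion h3

end Summit.MatrixMultiplication.OmegaCensus.CubeNB
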